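import Summits.BirchSwinnertonDyer.BirchSwinnertonDyer.Theorems.Rank2ObservatoryRank2CompleteBelow100000
import Summits.BirchSwinnertonDyer.BirchSwinnertonDyer.Theorems.Rank2ObservatoryRank2Rows20aComplete
import Summits.BirchSwinnertonDyer.BirchSwinnertonDyer.Theorems.Rank2ObservatoryRank2Rows20bComplete
import HarnessLib

/-!
# BirchSwinnertonDyer — rank ≥ 2 observatory: every rank-2 census curve of conductor < 105000 is certified

HONEST FRAMING: per-curve certified theorems and census instruments; no claim on BSD in rank ≥ 2.

EVERY rank-2 census curve of conductor `N < 105000` — every row `r ∈ rank2Table` (Cremona's table of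
the `348672` curves of rank `2` and conductor `< 500000`) with `r.N < 105000` — has an UNCONDITIONAL
kernel certificate `2 ≤ rank_ℤ E_r(ℚ)`. Reason: a row with `N < 105000` lies in one of the `36` tree
chunks `rank2Rows00 … rank2Rows20b` (every other chunk of decade 2 and every later decade has a
certified conductor range starting at `105000` or above), and each of those chunks is COMPLETE
(`Rank2ObservatoryRank2Rows<c>Complete`: merge certificates over the census-linked kernel-
certificate indices, every index row carrying a per-curve kernel `decide` certificate). Consequences
for all these curves: `L(E,1) = L′(E,1) = 0` exactly given only the named literature fact `hGZK`,
and `r_an = rank = 2` given `hGZK`, `hup`, `hL2`. This extends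
`Rank2ObservatoryRank2CompleteBelow100000` (conductor-ascending certification, chunk by chunk: new
chunks 20a, 20b); nothing is claimed for conductor `N ≥ 105000`.

References: [cite: CremonaAlgorithms1997, Table 1, §2.13, §3.5] (the census, `L^{(r)}(E,1)`, conductor ranges);
[cite: Darmon2004, Thm. 3.22] (Gross–Zagier–Kolyvagin); [cite: SilvermanAEC2009, Thm. VIII.6.7] (reduction injective on
prime-to-`p` torsion — the engine of the per-curve kernel certificates).
-/

namespace Summit.BirchSwinnertonDyer.BirchSwinnertonDyer.Rank2Observatory

open WeierstrassCurve Literature Literature.NumberTheory.EllipticCurves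

/-- **Every rank-2 census curve of conductor `N < 105000` has `2 ≤ rank_ℤ E(ℚ)`** — with NO hypothesis
(kernel certificates for every curve; chunk completeness by merge certificates for the 36 tree chunks
`rank2Rows00 … rank2Rows20b`; every other chunk / decade is excluded by its certified conductor range).
[cite: CremonaAlgorithms1997, Table 1, §3.5] [cite: SilvermanAEC2009, Thm. VIII.6.7] -/
theorem two_le_mordellWeilRank_of_mem_rank2Table_of_conductor_lt_105000 {r : Rank2Row} (hr : r ∈ rank2Table)
    (hN : r.N < 105000) : 2 ≤ r.curve.mordellWeilRank := by
  simp only [rank2Table, rank2Decades, List.flatten_cons, List.flatten_nil, List.mem_append,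
      List.not_mem_nil, or_false] at hr
  rcases hr with h | h | h | h | h | h | h | h | h | h
  · simp only [rank2Decade0, rank2Decade0Chunks, List.flatten_cons, List.flatten_nil, List.mem_append,
      List.not_mem_nil, or_false] at h
    rcases h with h | h | h | h | h | h | h | h | h | h | h | h | h | h
    exacts [
      two_le_mordellWeilRank_of_mem_rank2Rows00 h,
      two_le_mordellWeilRank_of_mem_rank2Rows01 h,
      two_le_mordellWeilRank_of_mem_rank2Rows02 h,
      two_le_mordellWeilRank_of_mem_rank2Rows03 h,
      two_le_mordellWeilRank_of_mem_rank2Rows04 h,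
      two_le_mordellWeilRank_of_mem_rank2Rows05 h,
      two_le_mordellWeilRank_of_mem_rank2Rows06a h,
      two_le_mordellWeilRank_of_mem_rank2Rows06b h,
      two_le_mordellWeilRank_of_mem_rank2Rows07a h,
      two_le_mordellWeilRank_of_mem_rank2Rows07b h,
      two_le_mordellWeilRank_of_mem_rank2Rows08a h,
      two_le_mordellWeilRank_of_mem_rank2Rows08b h,
      two_le_mordellWeilRank_of_mem_rank2Rows09a h,
      two_le_mordellWeilRank_of_mem_rank2Rows09b h]
  · simp only [rank2Decade1, rank2Decade1Chunks, List.flatten_cons, List.flatten_nil, List.mem_append,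
      List.not_mem_nil, or_false] at h
    rcases h with h | h | h | h | h | h | h | h | h | h | h | h | h | h | h | h | h | h | h | h
    exacts [
      two_le_mordellWeilRank_of_mem_rank2Rows10a h,
      two_le_mordellWeilRank_of_mem_rank2Rows10b h,
      two_le_mordellWeilRank_of_mem_rank2Rows11a h,
      two_le_mordellWeilRank_of_mem_rank2Rows11b h,
      two_le_mordellWeilRank_of_mem_rank2Rows12a h,
      two_le_mordellWeilRank_of_mem_rank2Rows12b h,
      two_le_mordellWeilRank_of_mem_rank2Rows13a h,
      two_le_mordellWeilRank_of_mem_rank2Rows13b h,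
      two_le_mordellWeilRank_of_mem_rank2Rows14a h,
      two_le_mordellWeilRank_of_mem_rank2Rows14b h,
      two_le_mordellWeilRank_of_mem_rank2Rows15a h,
      two_le_mordellWeilRank_of_mem_rank2Rows15b h,
      two_le_mordellWeilRank_of_mem_rank2Rows16a h,
      two_le_mordellWeilRank_of_mem_rank2Rows16b h,
      two_le_mordellWeilRank_of_mem_rank2Rows17a h,
      two_le_mordellWeilRank_of_mem_rank2Rows17b h,
      two_le_mordellWeilRank_of_mem_rank2Rows18a h,
      two_le_mordellWeilRank_of_mem_rank2Rows18b h,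
      two_le_mordellWeilRank_of_mem_rank2Rows19a h,
      two_le_mordellWeilRank_of_mem_rank2Rows19b h]
  · simp only [rank2Decade2, rank2Decade2Chunks, List.flatten_cons, List.flatten_nil, List.mem_append,
      List.not_mem_nil, or_false] at h
    rcases h with h | h | h | h | h | h | h | h | h | h | h | h | h | h | h | h | h | h | h | h
    exacts [
      two_le_mordellWeilRank_of_mem_rank2Rows20a h,
      two_le_mordellWeilRank_of_mem_rank2Rows20b h,
      absurd hN (not_lt.mpr (le_conductor_of_all_range rank2Rows21a_conductor h)),
      absurd hN (not_lt.mpr (le_trans (by norm_num) (le_conductor_of_all_range rank2Rows21b_conductor h))),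
      absurd hN (not_lt.mpr (le_trans (by norm_num) (le_conductor_of_all_range rank2Rows22a_conductor h))),
      absurd hN (not_lt.mpr (le_trans (by norm_num) (le_conductor_of_all_range rank2Rows22b_conductor h))),
      absurd hN (not_lt.mpr (le_trans (by norm_num) (le_conductor_of_all_range rank2Rows23a_conductor h))),
      absurd hN (not_lt.mpr (le_trans (by norm_num) (le_conductor_of_all_range rank2Rows23b_conductor h))),
      absurd hN (not_lt.mpr (le_trans (by norm_num) (le_conductor_of_all_range rank2Rows24a_conductor h))),
      absurd hN (not_lt.mpr (le_trans (by norm_num) (le_conductor_of_all_range rank2Rows24b_conductor h))),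
      absurd hN (not_lt.mpr (le_trans (by norm_num) (le_conductor_of_all_range rank2Rows25a_conductor h))),
      absurd hN (not_lt.mpr (le_trans (by norm_num) (le_conductor_of_all_range rank2Rows25b_conductor h))),
      absurd hN (not_lt.mpr (le_trans (by norm_num) (le_conductor_of_all_range rank2Rows26a_conductor h))),
      absurd hN (not_lt.mpr (le_trans (by norm_num) (le_conductor_of_all_range rank2Rows26b_conductor h))),
      absurd hN (not_lt.mpr (le_trans (by norm_num) (le_conductor_of_all_range rank2Rows27a_conductor h))),
      absurd hN (not_lt.mpr (le_trans (by norm_num) (le_conductor_of_all_range rank2Rows27b_conductor h))),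
      absurd hN (not_lt.mpr (le_trans (by norm_num) (le_conductor_of_all_range rank2Rows28a_conductor h))),
      absurd hN (not_lt.mpr (le_trans (by norm_num) (le_conductor_of_all_range rank2Rows28b_conductor h))),
      absurd hN (not_lt.mpr (le_trans (by norm_num) (le_conductor_of_all_range rank2Rows29a_conductor h))),
      absurd hN (not_lt.mpr (le_trans (by norm_num) (le_conductor_of_all_range rank2Rows29b_conductor h)))]
  · exact absurd hN (not_lt.mpr (le_trans (by norm_num) (le_conductor_of_mem_rank2Decade3 h)))
  · exact absurd hN (not_lt.mpr (le_trans (by norm_num) (le_conductor_of_mem_rank2Decade4 h)))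
  · exact absurd hN (not_lt.mpr (le_trans (by norm_num) (le_conductor_of_mem_rank2Decade5 h)))
  · exact absurd hN (not_lt.mpr (le_trans (by norm_num) (le_conductor_of_mem_rank2Decade6 h)))
  · exact absurd hN (not_lt.mpr (le_trans (by norm_num) (le_conductor_of_mem_rank2Decade7 h)))
  · exact absurd hN (not_lt.mpr (le_trans (by norm_num) (le_conductor_of_mem_rank2Decade8 h)))
  · exact absurd hN (not_lt.mpr (le_trans (by norm_num) (le_conductor_of_mem_rank2Decade9 h)))

/-- **Exact vanishing `L(E,1) = L′(E,1) = 0` for every rank-2 census curve of conductor `N < 105000`**,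
given ONLY the named literature fact `hGZK` (Gross–Zagier–Kolyvagin: `r_an ≤ 1 → rank = r_an`).
[cite: Darmon2004, Thm. 3.22] [cite: CremonaAlgorithms1997, §2.13] -/
theorem lvalue_lderiv_eq_zero_of_mem_rank2Table_of_conductor_lt_105000 {r : Rank2Row} (hr : r ∈ rank2Table)
    (hN : r.N < 105000) (hGZK : rank_eq_analyticRank_of_analyticRank_le_one) :
    r.curve.entireLFunction 1 = 0 ∧ deriv r.curve.entireLFunction 1 = 0 :=
  ⟨rank2_lvalue_eq_zero_of_mem hr hGZK
      (two_le_mordellWeilRank_of_mem_rank2Table_of_conductor_lt_105000 hr hN),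
    rank2_lderiv_eq_zero_of_mem hr hGZK
      (two_le_mordellWeilRank_of_mem_rank2Table_of_conductor_lt_105000 hr hN)⟩

/-- **`r_an(E) = rank_ℤ E(ℚ) = 2` for every rank-2 census curve of conductor `N < 105000`** with the
certificate field `rank_lower` DISCHARGED; remaining named hypotheses `hGZK` (literature), `hup`
(2-descent upper bound), `hL2` (`L″(E,1) ≠ 0`). [cite: CremonaAlgorithms1997, §2.13]
[cite: Darmon2004, Thm. 3.22] -/
theorem analyticRank_eq_rank_of_mem_rank2Table_of_conductor_lt_105000 {r : Rank2Row} (hr : r ∈ rank2Table)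
    (hN : r.N < 105000) (hGZK : rank_eq_analyticRank_of_analyticRank_le_one)
    (hup : r.curve.mordellWeilRank ≤ 2) (hL2 : iteratedDeriv 2 r.curve.entireLFunction 1 ≠ 0) :
    r.curve.analyticRank = r.curve.mordellWeilRank ∧ r.curve.analyticRank = 2 :=
  ⟨rank2_analyticRank_eq_rank_of_mem hr hGZK
      (two_le_mordellWeilRank_of_mem_rank2Table_of_conductor_lt_105000 hr hN) hup hL2,
    rank2_analyticRank_eq_two_of_mem hr hGZK
      (two_le_mordellWeilRank_of_mem_rank2Table_of_conductor_lt_105000 hr hN) hup hL2⟩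

end Summit.BirchSwinnertonDyer.BirchSwinnertonDyer.Rank2Observatory
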